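import Literature.AlgebraicGeometry.Resolution.BertiniAffine
import Literature.AlgebraicGeometry.Resolution.FieldsJ2
import Mathlib.LinearAlgebra.Basis.VectorSpace
import HarnessLib

/-!
# Bertini's theorem on the regular locus, and the elementary generic conditions

Topic: `Literature/AlgebraicGeometry/Resolution`. Complements to `BertiniAffine.lean`
(Hartshorne II.8.18 in affine local-algebra form), in the same namespace `BertiniAffine`:

* `isGeneric_ne_zero_of_linearMap` — a non-zero linear functional is generically non-zero;
  `isGeneric_linComb_notMem` — **a generic hyperplane misses a given closed point**;
  `isGeneric_linCombQuotSq_notMem` — **a generic hyperplane has its value-and-differential at a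
  closed point outside a given proper subspace** (the independence conditions used to make
  finitely many prescribed differentials linearly independent);
* `isGeneric_isRegularLocalRing_quotient_linComb_of_isRegularLocalRing` — **Bertini on the
  regular locus**: for `A` of finite type over an algebraically closed field (no regularity
  assumption) and `u` separating tangent vectors, a generic hyperplane section `V(s_t)` is
  regular at every closed point of `V(s_t)` at which `Spec A` itself is regular (Hartshorne
  II.8.18 is stated for a nonsingular quasi-projective `X`; here `X = Reg(Spec A)`, covered by
  finitely many regular affine pieces `Spec A_g`, to each of which `BertiniAffine` applies).

## References

* R. Hartshorne, *Algebraic Geometry*, GTM 52 (1977), II Thm. 8.18. [Hartshorne1977]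
* H. Matsumura, *Commutative Ring Theory* (1986), §30 Cor. to Thm. 30.5 (openness of the regular
  locus over a field). [Matsumura1987]
-/

noncomputable section

open IsLocalRing MvPolynomial

universe u v

namespace Literature.AlgebraicGeometry.Resolution

namespace BertiniAffine

variable {k : Type u} [Field k] {A : Type u} [CommRing A] [Algebra k A]
variable {ι : Type v} [Fintype ι]

/-! ### Elementary generic conditions -/

/-- **A non-zero linear functional is generically non-zero**: `{t | φ t ≠ 0}` contains the
non-vanishing locus of the (non-zero, linear) polynomial `Σⱼ φ(eⱼ) aⱼ`. [folklore] -/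
theorem isGeneric_ne_zero_of_linearMap [DecidableEq ι] (φ : (ι → k) →ₗ[k] k) (hφ : φ ≠ 0) :
    IsGeneric fun t : ι → k => φ t ≠ 0 := by
  let Φ : MvPolynomial ι k := ∑ j, C (φ (Pi.single j 1)) * X j
  have heval : ∀ t : ι → k, MvPolynomial.eval t Φ = φ t := by
    intro t
    conv_rhs => rw [← sum_smul_single t]
    simp only [Φ, map_sum, map_mul, MvPolynomial.eval_C, MvPolynomial.eval_X, map_smul,
      smul_eq_mul]
    exact Finset.sum_congr rfl fun j _ => mul_comm _ _
  have hΦ : Φ ≠ 0 := by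
    obtain ⟨t, ht⟩ : ∃ t, φ t ≠ 0 := by
      by_contra h
      have h' : ∀ t, φ t = 0 := fun t => not_not.mp (not_exists.mp h t)
      exact hφ (LinearMap.ext fun t => by rw [h' t, LinearMap.zero_apply])
    intro h0
    apply ht
    rw [← heval, h0, map_zero]
  exact ⟨Φ, hΦ, fun t ht => by rwa [heval] at ht⟩

/-- **A generic hyperplane misses a given closed point**: if some `uⱼ ∉ 𝔪` (e.g. the constant
`1` is among the `uⱼ`), then `s_t ∉ 𝔪` for generic `t`. [folklore] -/
theorem isGeneric_linComb_notMem [IsAlgClosed k] [Algebra.FiniteType k A] (u : ι → A)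
    (𝔪 : Ideal A) [𝔪.IsMaximal] (h : ∃ j, u j ∉ 𝔪) :
    IsGeneric fun t : ι → k => linComb u t ∉ 𝔪 := by
  classical
  let e : k ≃ₐ[k] A ⧸ 𝔪 :=
    AlgEquiv.ofBijective (Algebra.ofId k (A ⧸ 𝔪)) (algebraMap_quotient_bijective 𝔪)
  let L : (ι → k) →ₗ[k] A ⧸ 𝔪 :=
    Fintype.linearCombination k fun j => Ideal.Quotient.mk 𝔪 (u j)
  have hL : ∀ t, L t = Ideal.Quotient.mk 𝔪 (linComb u t) := by
    intro t
    simp only [L, Fintype.linearCombination_apply, linComb, map_sum]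
    refine Finset.sum_congr rfl fun j _ => ?_
    change _ = Ideal.Quotient.mkₐ k 𝔪 (t j • u j)
    rw [map_smul]; rfl
  let φ : (ι → k) →ₗ[k] k := e.symm.toLinearEquiv.toLinearMap ∘ₗ L
  have hφ : φ ≠ 0 := by
    obtain ⟨j, hj⟩ := h
    intro h0
    have h1 : φ (Pi.single j 1) = 0 := by rw [h0, LinearMap.zero_apply]
    have h2 : L (Pi.single j 1) = 0 := by
      have := congrArg e h1
      simpa [φ] using this
    rw [hL, Ideal.Quotient.eq_zero_iff_mem] at h2
    apply hj
    simpa [linComb, Finset.sum_pi_single', Pi.single_apply] using h2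
  refine (isGeneric_ne_zero_of_linearMap φ hφ).mono fun t ht hmem => ht ?_
  change e.symm.toLinearEquiv (L t) = 0
  rw [hL, Ideal.Quotient.eq_zero_iff_mem.2 hmem, map_zero]

/-- **A generic hyperplane has its 1-jet at a closed point outside a given proper subspace**: if
`t ↦ s_t mod 𝔪²` is surjective and `W ⊊ A ⧸ 𝔪²` is a proper subspace, then `s_t mod 𝔪² ∉ W`
for generic `t` (used with `W = span` of previously chosen jets: independence conditions).
[folklore] -/
theorem isGeneric_linCombQuotSq_notMem [DecidableEq ι] (u : ι → A) (𝔪 : Ideal A)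
    (hu : Function.Surjective (linCombQuotSq (k := k) u 𝔪)) (W : Submodule k (A ⧸ 𝔪 ^ 2))
    (hW : W < ⊤) : IsGeneric fun t : ι → k => linCombQuotSq (k := k) u 𝔪 t ∉ W := by
  obtain ⟨ψ, hψ, hWψ⟩ := W.exists_le_ker_of_lt_top hW
  let φ : (ι → k) →ₗ[k] k := ψ ∘ₗ linCombQuotSq (k := k) u 𝔪
  have hφ : φ ≠ 0 := by
    intro h0
    apply hψ
    apply LinearMap.ext
    intro v
    obtain ⟨t, rfl⟩ := hu v
    change φ t = 0
    rw [h0, LinearMap.zero_apply]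
  refine (isGeneric_ne_zero_of_linearMap φ hφ).mono fun t ht hmem => ht ?_
  exact LinearMap.mem_ker.1 (hWψ hmem)

/-! ### The tangent-separation hypothesis from algebra generators -/

/-- **Generators containing `1` separate tangent vectors**: if the `uⱼ` generate `A` as a
`k`-algebra and one of them is `1`, then at every closed point `𝔪` with residue field `k` the map
`t ↦ Σ tⱼ uⱼ mod 𝔪²` is surjective (a monomial in the `uⱼ = cⱼ + nⱼ`, `nⱼ ∈ 𝔪`, is congruent
modulo `𝔪²` to a `k`-combination of `1` and the `nⱼ`). [folklore] -/
theorem surjective_linCombQuotSq_of_adjoin_eq_top [IsAlgClosed k] [Algebra.FiniteType k A]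
    (u : ι → A) (hgen : Algebra.adjoin k (Set.range u) = ⊤) {j₀ : ι} (hj₀ : u j₀ = 1)
    (𝔪 : Ideal A) [𝔪.IsMaximal] : Function.Surjective (linCombQuotSq (k := k) u 𝔪) := by
  classical
  -- values `cⱼ ∈ k` of the `uⱼ` at `𝔪`
  have hval : ∀ a : A, ∃ c : k, a - algebraMap k A c ∈ 𝔪 := by
    intro a
    obtain ⟨c, hc⟩ := (algebraMap_quotient_bijective (k := k) 𝔪).2 (Ideal.Quotient.mk 𝔪 a)
    refine ⟨c, ?_⟩
    rw [← Ideal.Quotient.eq_zero_iff_mem, map_sub, sub_eq_zero, ← hc]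
    rfl
  choose c hc using hval
  -- the range `V` of `linCombQuotSq`
  let V : Submodule k (A ⧸ 𝔪 ^ 2) := LinearMap.range (linCombQuotSq (k := k) u 𝔪)
  have hVmk : ∀ j, Ideal.Quotient.mk (𝔪 ^ 2) (u j) ∈ V := fun j =>
    ⟨Pi.single j 1, by
      rw [linCombQuotSq_apply]
      simp [linComb, Pi.single_apply, Finset.sum_ite_eq', Finset.mem_univ]⟩
  have hV1 : (1 : A ⧸ 𝔪 ^ 2) ∈ V := by
    have := hVmk j₀; rwa [hj₀, map_one] at this
  have hValg : ∀ x : k, algebraMap k (A ⧸ 𝔪 ^ 2) x ∈ V := fun x => by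
    rw [Algebra.algebraMap_eq_smul_one]; exact V.smul_mem x hV1
  -- `V` is stable under multiplication by the generators
  have hmul : ∀ (j : ι) (v : A ⧸ 𝔪 ^ 2), v ∈ V → Ideal.Quotient.mk (𝔪 ^ 2) (u j) * v ∈ V := by
    intro j v hv
    obtain ⟨t, rfl⟩ := hv
    rw [linCombQuotSq_apply, ← map_mul, linComb, Finset.mul_sum]
    rw [map_sum]
    refine V.sum_mem fun l _ => ?_
    -- `u_j (t_l u_l) ≡ t_l (c_j u_l + c_l u_j - c_j c_l)` modulo `𝔪²`
    have hkey : u j * (t l • u l) - t l • (c (u j) • u l + c (u l) • u j -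
        algebraMap k A (c (u j) * c (u l))) ∈ 𝔪 ^ 2 := by
      have h1 : u j * (t l • u l) - t l • (c (u j) • u l + c (u l) • u j -
          algebraMap k A (c (u j) * c (u l))) =
          t l • ((u j - algebraMap k A (c (u j))) * (u l - algebraMap k A (c (u l)))) := by
        simp only [Algebra.smul_def, map_mul]; ring
      rw [h1, Algebra.smul_def]
      exact Ideal.mul_mem_left _ _ (by rw [pow_two]; exact Ideal.mul_mem_mul (hc _) (hc _))
    have h2 : Ideal.Quotient.mk (𝔪 ^ 2) (u j * (t l • u l)) = Ideal.Quotient.mk (𝔪 ^ 2)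
        (t l • (c (u j) • u l + c (u l) • u j - algebraMap k A (c (u j) * c (u l)))) := by
      rw [Ideal.Quotient.mk_eq_mk_iff_sub_mem]; exact hkey
    rw [h2]
    change Ideal.Quotient.mkₐ k (𝔪 ^ 2) _ ∈ V
    rw [map_smul]
    refine V.smul_mem _ ?_
    simp only [Ideal.Quotient.mkₐ_eq_mk, map_sub, map_add]
    refine V.sub_mem (V.add_mem ?_ ?_) ?_
    · change Ideal.Quotient.mkₐ k (𝔪 ^ 2) _ ∈ V
      rw [map_smul]; exact V.smul_mem _ (hVmk l)
    · change Ideal.Quotient.mkₐ k (𝔪 ^ 2) _ ∈ V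
      rw [map_smul]; exact V.smul_mem _ (hVmk j)
    · exact hValg _
  -- hence `V` contains the subalgebra generated by the `uⱼ`, i.e. everything
  have hall : ∀ a : A, Ideal.Quotient.mk (𝔪 ^ 2) a ∈ V := by
    intro a
    have ha : a ∈ Algebra.adjoin k (Set.range u) := by rw [hgen]; exact Algebra.mem_top
    refine Algebra.adjoin_induction (fun x hx => ?_) (fun x => ?_) (fun x y _ _ hx hy => ?_)
      (fun x y hx' _ hx hy => ?_) ha
    · obtain ⟨j, rfl⟩ := hx; exact hVmk j
    · rw [Ideal.Quotient.mk_algebraMap]; exact hValg x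
    · rw [map_add]; exact V.add_mem hx hy
    · -- `x ∈ adjoin`: reduce to generators by a second induction on `x`
      rw [map_mul]
      have hgen' : ∀ v ∈ V, Ideal.Quotient.mk (𝔪 ^ 2) x * v ∈ V := by
        refine Algebra.adjoin_induction (p := fun x _ => ∀ v ∈ V, Ideal.Quotient.mk (𝔪 ^ 2) x * v ∈ V)
          (fun x hx v hv => ?_) (fun x v hv => ?_) (fun x x' _ _ hx hx' v hv => ?_)
          (fun x x' _ _ hx hx' v hv => ?_) hx'
        · obtain ⟨j, rfl⟩ := hx; exact hmul j _ hv
        · rw [Ideal.Quotient.mk_algebraMap, ← Algebra.smul_def]; exact V.smul_mem _ hv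
        · rw [map_add, add_mul]; exact V.add_mem (hx v hv) (hx' v hv)
        · rw [map_mul, mul_assoc]; exact hx _ (hx' v hv)
      exact hgen' _ hy
  intro y
  obtain ⟨a, rfl⟩ := Ideal.Quotient.mk_surjective y
  exact hall a

/-! ### Localization bookkeeping -/

section Away

variable (g : A)

/-- `s_t` for the functions `algebraMap ∘ u` is the image of `s_t`. [folklore] -/
theorem linComb_comp_algebraMap {B : Type u} [CommRing B] [Algebra k B] [Algebra A B]
    [IsScalarTower k A B] (u : ι → A) (t : ι → k) :
    linComb (fun j => algebraMap A B (u j)) t = algebraMap A B (linComb u t) := by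
  simp only [linComb, map_sum, Algebra.smul_def, map_mul, ← IsScalarTower.algebraMap_apply]

/-- A prime of `A_g` is maximal as soon as its contraction to `A` is. [folklore] -/
theorem isMaximal_of_isMaximal_under_away (𝔫 : Ideal (Localization.Away g)) [𝔫.IsPrime]
    (h : (𝔫.under A).IsMaximal) : 𝔫.IsMaximal := by
  refine ⟨⟨Ideal.IsPrime.ne_top inferInstance, fun J hJ => ?_⟩⟩
  by_contra hJtop
  have hle : 𝔫.under A ≤ J.under A := Ideal.comap_mono hJ.le
  have hJne : J.under A ≠ ⊤ := Ideal.comap_ne_top _ hJtop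
  have heq : 𝔫.under A = J.under A := h.eq_of_le hJne hle
  have h1 : (J.under A).map (algebraMap A (Localization.Away g)) = J :=
    IsLocalization.map_under (Submonoid.powers g) _ J
  have h2 : (𝔫.under A).map (algebraMap A (Localization.Away g)) = 𝔫 :=
    IsLocalization.map_under (Submonoid.powers g) _ 𝔫
  rw [← h1, ← heq, h2] at hJ
  exact lt_irrefl _ hJ

/-- For `g ∉ 𝔪`, `𝔪` maximal, `𝔪 A_g` is a maximal ideal of `A_g` contracting to `𝔪`. [folklore] -/
theorem isMaximal_map_away (𝔪 : Ideal A) [𝔪.IsMaximal] (hg : g ∉ 𝔪) :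
    (𝔪.map (algebraMap A (Localization.Away g))).IsMaximal ∧
      (𝔪.map (algebraMap A (Localization.Away g))).under A = 𝔪 := by
  have hdisj : Disjoint (Submonoid.powers g : Set A) 𝔪 := by
    rw [Set.disjoint_left]
    rintro _ ⟨n, rfl⟩ hn
    exact hg ((inferInstance : 𝔪.IsPrime).mem_of_pow_mem n hn)
  have hprime : (𝔪.map (algebraMap A (Localization.Away g))).IsPrime :=
    IsLocalization.isPrime_of_isPrime_disjoint (Submonoid.powers g) _ 𝔪 inferInstance hdisj
  have hunder : (𝔪.map (algebraMap A (Localization.Away g))).under A = 𝔪 :=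
    IsLocalization.under_map_of_isPrime_disjoint (Submonoid.powers g) _ inferInstance hdisj
  haveI := hprime
  exact ⟨isMaximal_of_isMaximal_under_away g _ (by rw [hunder]; infer_instance), hunder⟩

/-- `𝔪² ≤ ((𝔪 A_g)²) ∩ A`. [folklore] -/
theorem sq_le_comap_map_sq (𝔪 : Ideal A) :
    𝔪 ^ 2 ≤ ((𝔪.map (algebraMap A (Localization.Away g))) ^ 2).comap
      (algebraMap A (Localization.Away g)) := by
  rw [← Ideal.map_pow]; exact Ideal.le_comap_map

/-- **`A ⧸ 𝔪² → A_g ⧸ (𝔪 A_g)²` is surjective** for `g ∉ 𝔪` (`g` is a unit modulo `𝔪²`).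
[folklore] -/
theorem quotient_sq_map_away_surjective (𝔪 : Ideal A) [𝔪.IsMaximal] (hg : g ∉ 𝔪) :
    Function.Surjective (Ideal.quotientMap
      ((𝔪.map (algebraMap A (Localization.Away g))) ^ 2) (algebraMap A (Localization.Away g))
      (sq_le_comap_map_sq g 𝔪)) := by
  let Ag := Localization.Away g
  let 𝔫 := 𝔪.map (algebraMap A Ag)
  let θ := Ideal.quotientMap (𝔫 ^ 2) (algebraMap A Ag) (sq_le_comap_map_sq g 𝔪)
  have hθ : ∀ a : A, θ (Ideal.Quotient.mk _ a) = Ideal.Quotient.mk _ (algebraMap A Ag a) :=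
    fun a => Ideal.quotientMap_mk
  -- `g` is a unit modulo `𝔪²`
  have hunit : IsUnit (Ideal.Quotient.mk (𝔪 ^ 2) g) := by
    by_contra hng
    obtain ⟨M, hM, hgM⟩ := exists_max_ideal_of_mem_nonunits hng
    haveI := hM
    have hmax : (M.comap (Ideal.Quotient.mk (𝔪 ^ 2))).IsMaximal :=
      Ideal.comap_isMaximal_of_surjective _ Ideal.Quotient.mk_surjective
    have hM' : M.comap (Ideal.Quotient.mk (𝔪 ^ 2)) = 𝔪 := by
      refine ((inferInstance : 𝔪.IsMaximal).eq_of_le hmax.ne_top ?_).symm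
      intro m hm
      have hsq : 𝔪 ^ 2 ≤ M.comap (Ideal.Quotient.mk (𝔪 ^ 2)) := fun x hx => by
        rw [Ideal.mem_comap, Ideal.Quotient.eq_zero_iff_mem.2 hx]; exact zero_mem _
      have hrad : 𝔪 ≤ (M.comap (Ideal.Quotient.mk (𝔪 ^ 2))).radical := fun x hx =>
        ⟨2, hsq (Ideal.pow_mem_pow hx 2)⟩
      rw [Ideal.IsPrime.radical (Ideal.comap_isPrime _ _)] at hrad
      exact hrad hm
    apply hg
    rw [← hM', Ideal.mem_comap]
    exact hgM
  obtain ⟨b, hb⟩ := hunit.exists_right_inv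
  obtain ⟨b, rfl⟩ := Ideal.Quotient.mk_surjective b
  intro y
  obtain ⟨y, rfl⟩ := Ideal.Quotient.mk_surjective y
  obtain ⟨a, s, rfl⟩ := IsLocalization.exists_mk'_eq (Submonoid.powers g) y
  obtain ⟨n, hn⟩ := (Submonoid.mem_powers_iff _ _).1 s.2
  refine ⟨Ideal.Quotient.mk _ (a * b ^ n), ?_⟩
  change θ _ = _
  rw [hθ]
  -- `mk b` is the inverse of `mk g` modulo `𝔫²`
  have hgb : Ideal.Quotient.mk (𝔫 ^ 2) (algebraMap A Ag g) *
      Ideal.Quotient.mk (𝔫 ^ 2) (algebraMap A Ag b) = 1 := by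
    have := congrArg θ hb
    rwa [map_mul, map_one, hθ, hθ] at this
  have hmk : IsLocalization.mk' Ag a s * algebraMap A Ag (g ^ n) = algebraMap A Ag a := by
    rw [hn]; exact IsLocalization.mk'_spec Ag a s
  have h3 : Ideal.Quotient.mk (𝔫 ^ 2) (IsLocalization.mk' Ag a s) *
      Ideal.Quotient.mk (𝔫 ^ 2) (algebraMap A Ag g) ^ n =
      Ideal.Quotient.mk (𝔫 ^ 2) (algebraMap A Ag a) := by
    rw [← map_pow, ← map_mul, ← map_pow, hmk]
  rw [map_mul, map_pow, map_mul, map_pow, ← h3, mul_assoc, ← mul_pow, hgb, one_pow, mul_one]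

end Away

/-! ### Bertini on the regular locus -/

set_option synthInstance.maxHeartbeats 80000 in
set_option maxHeartbeats 800000 in
/-- **Bertini's theorem on the regular locus** (Hartshorne II.8.18 for the nonsingular
quasi-projective scheme `Reg(Spec A)`): for `A` of finite type over an algebraically closed
field `k` and `u : ι → A` with `t ↦ Σ tⱼ uⱼ mod 𝔪²` surjective at every closed point, a generic
hyperplane section `V(s_t)` is regular at each of its closed points at which `Spec A` is
regular: `A_𝔪 ⧸ (s_t)` is a regular local ring for every maximal `𝔪 ∋ s_t` with `A_𝔪` regular.
The regular locus is open (Matsumura §30, `isOpen_regularLocus_of_finiteType_field`), hence a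
finite union of basic opens `D(g)` with `A_g` regular, and `BertiniAffine` applies to each
`A_g`. [cite: Hartshorne1977, II Thm. 8.18] -/
theorem isGeneric_isRegularLocalRing_quotient_linComb_of_isRegularLocalRing [IsAlgClosed k]
    [Algebra.FiniteType k A] (u : ι → A)
    (hu : ∀ 𝔪 : Ideal A, 𝔪.IsMaximal → Function.Surjective (linCombQuotSq (k := k) u 𝔪)) :
    IsGeneric fun t : ι → k => ∀ (𝔪 : Ideal A) [𝔪.IsMaximal],
      IsRegularLocalRing (Localization.AtPrime 𝔪) → linComb u t ∈ 𝔪 →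
        IsRegularLocalRing (Localization.AtPrime 𝔪 ⧸
          Ideal.span {algebraMap A (Localization.AtPrime 𝔪) (linComb u t)}) := by
  classical
  haveI : IsNoetherianRing A := Algebra.FiniteType.isNoetherianRing k A
  -- a finite cover of the (open) regular locus by basic opens
  have hopen : IsOpen (regularLocus A) := isOpen_regularLocus_of_finiteType_field k A
  have hcov : ∀ p ∈ regularLocus A, ∃ g : A, p ∈ PrimeSpectrum.basicOpen g ∧
      (PrimeSpectrum.basicOpen g : Set (PrimeSpectrum A)) ⊆ regularLocus A := by
    intro p hp
    obtain ⟨_, ⟨g, rfl⟩, hpg, hsub⟩ :=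
      PrimeSpectrum.isTopologicalBasis_basic_opens.exists_subset_of_mem_open hp hopen
    exact ⟨g, hpg, hsub⟩
  choose! gOf hgOf hgsub using hcov
  obtain ⟨G, hGcov⟩ := (TopologicalSpace.NoetherianSpace.isCompact (regularLocus A)).elim_finite_subcover
    (fun p : regularLocus A => (PrimeSpectrum.basicOpen (gOf p.1) : Set (PrimeSpectrum A)))
    (fun p => (PrimeSpectrum.basicOpen _).isOpen)
    (fun p hp => Set.mem_iUnion.2 ⟨⟨p, hp⟩, hgOf p hp⟩)
  -- Bertini for each piece `A_g`
  have hpiece : ∀ p : regularLocus A, IsGeneric fun t : ι → k => ∀ (𝔪 : Ideal A) [𝔪.IsMaximal],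
      gOf p.1 ∉ 𝔪 → linComb u t ∈ 𝔪 →
        IsRegularLocalRing (Localization.AtPrime 𝔪 ⧸
          Ideal.span {algebraMap A (Localization.AtPrime 𝔪) (linComb u t)}) := by
    intro p
    set g := gOf p.1 with hgdef
    have hg : (PrimeSpectrum.basicOpen g : Set (PrimeSpectrum A)) ⊆ regularLocus A := hgsub p.1 p.2
    let Ag := Localization.Away g
    -- `A_g` is regular, of finite type, and `u` still separates tangent vectors there
    haveI : IsNoetherianRing Ag := IsLocalization.isNoetherianRing (Submonoid.powers g) Ag inferInstance
    haveI : IsRegularRing Ag := by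
      refine (isRegularRing_iff (R := Ag)).2 fun P hP => ?_
      haveI := hP
      haveI : IsLocalization.AtPrime (Localization.AtPrime P) (P.under A) :=
        IsLocalization.isLocalization_isLocalization_atPrime_isLocalization
          (Submonoid.powers g) (Localization.AtPrime P) P
      have hmem : (⟨P.under A, inferInstance⟩ : PrimeSpectrum A) ∈ regularLocus A := by
        apply hg
        rw [SetLike.mem_coe, PrimeSpectrum.mem_basicOpen]
        intro hgP
        have : IsUnit (algebraMap A Ag g) := IsLocalization.Away.algebraMap_isUnit g
        exact hP.ne_top (P.eq_top_of_isUnit_mem hgP this)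
      rw [mem_regularLocus] at hmem
      exact IsRegularLocalRing.of_ringEquiv (R := Localization.AtPrime (P.under A))
        (IsLocalization.algEquiv (P.under A).primeCompl (Localization.AtPrime (P.under A))
          (Localization.AtPrime P)).toRingEquiv
    haveI : Algebra.FiniteType A Ag := IsLocalization.finiteType_of_monoid_fg (Submonoid.powers g) Ag
    haveI : Algebra.FiniteType k Ag := Algebra.FiniteType.trans (S := A) inferInstance inferInstance
    let ug : ι → Ag := fun j => algebraMap A Ag (u j)
    have hug : ∀ 𝔫 : Ideal Ag, 𝔫.IsMaximal → Function.Surjective (linCombQuotSq (k := k) ug 𝔫) := by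
      intro 𝔫 h𝔫
      haveI := h𝔫
      haveI : (𝔫.under A).IsMaximal := isMaximal_under_of_isMaximal' (K := k) (T := A) 𝔫
      have hgn : g ∉ 𝔫.under A := fun hmem => h𝔫.ne_top
        (𝔫.eq_top_of_isUnit_mem (Ideal.mem_comap.1 hmem) (IsLocalization.Away.algebraMap_isUnit g))
      have h𝔫eq : (𝔫.under A).map (algebraMap A Ag) = 𝔫 :=
        IsLocalization.map_under (Submonoid.powers g) Ag 𝔫
      intro y
      -- `A ⧸ 𝔪² ↠ A_g ⧸ (𝔪A_g)² = A_g ⧸ 𝔫²`, `𝔪 = 𝔫 ∩ A`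
      have hsurj := quotient_sq_map_away_surjective g (𝔫.under A) hgn
      let e₂ : Ag ⧸ ((𝔫.under A).map (algebraMap A Ag)) ^ 2 ≃+* Ag ⧸ 𝔫 ^ 2 :=
        Ideal.quotEquivOfEq (by rw [h𝔫eq])
      obtain ⟨a, ha⟩ := hsurj (e₂.symm y)
      obtain ⟨t, rfl⟩ := hu (𝔫.under A) inferInstance a
      refine ⟨t, ?_⟩
      have h1 : linCombQuotSq (k := k) ug 𝔫 t = e₂ (Ideal.quotientMap
          (((𝔫.under A).map (algebraMap A Ag)) ^ 2) (algebraMap A Ag)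
          (sq_le_comap_map_sq g _) (linCombQuotSq (k := k) u (𝔫.under A) t)) := by
        rw [linCombQuotSq_apply, linCombQuotSq_apply, Ideal.quotientMap_mk, linComb_comp_algebraMap]
        exact (Ideal.quotEquivOfEq_mk _ _).symm
      rw [h1, ha, RingEquiv.apply_symm_apply]
    have hB := isGeneric_isRegularLocalRing_quotient_linComb (k := k) (A := Ag) (u := ug) hug
    refine hB.mono fun t ht 𝔪 h𝔪 hgm hst => ?_
    -- transfer from `(A_g)_{𝔪 A_g}` to `A_𝔪`
    obtain ⟨h𝔫max, h𝔫under⟩ := isMaximal_map_away g 𝔪 hgm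
    set 𝔫 := 𝔪.map (algebraMap A Ag) with h𝔫def
    haveI := h𝔫max
    have hst' : linComb ug t ∈ 𝔫 := by
      rw [linComb_comp_algebraMap]; exact Ideal.mem_map_of_mem _ hst
    have hreg := ht 𝔫 hst'
    haveI : IsLocalization.AtPrime (Localization.AtPrime 𝔫) (𝔫.under A) :=
      IsLocalization.isLocalization_isLocalization_atPrime_isLocalization
        (Submonoid.powers g) (Localization.AtPrime 𝔫) 𝔫
    have hpc : (𝔫.under A).primeCompl = 𝔪.primeCompl := by
      ext x; rw [Ideal.mem_primeCompl_iff, Ideal.mem_primeCompl_iff, h𝔫under]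
    haveI : IsLocalization.AtPrime (Localization.AtPrime 𝔫) 𝔪 := by
      change IsLocalization 𝔪.primeCompl _
      rw [← hpc]; exact this
    let e : Localization.AtPrime 𝔫 ≃ₐ[A] Localization.AtPrime 𝔪 :=
      IsLocalization.algEquiv 𝔪.primeCompl (Localization.AtPrime 𝔫) (Localization.AtPrime 𝔪)
    have hx : e (algebraMap Ag (Localization.AtPrime 𝔫) (linComb ug t)) =
        algebraMap A (Localization.AtPrime 𝔪) (linComb u t) := by
      rw [linComb_comp_algebraMap, ← IsScalarTower.algebraMap_apply, e.commutes]
    haveI := hreg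
    refine IsRegularLocalRing.of_ringEquiv (R := Localization.AtPrime 𝔫 ⧸
      Ideal.span {algebraMap Ag (Localization.AtPrime 𝔫) (linComb ug t)}) ?_
    refine Ideal.quotientEquiv _ _ e.toRingEquiv ?_
    rw [Ideal.map_span, Set.image_singleton]
    exact congrArg (fun z => Ideal.span {z}) hx.symm
  -- put the pieces together
  have hall := IsGeneric.forall_mem_finite (k := k) G.finite_toSet fun p _ => hpiece p
  refine hall.mono fun t ht 𝔪 h𝔪 hreg hst => ?_
  have hmem : (⟨𝔪, inferInstance⟩ : PrimeSpectrum A) ∈ regularLocus A := by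
    rw [mem_regularLocus]; exact hreg
  obtain ⟨p, hpG, hp𝔪⟩ := Set.mem_iUnion₂.1 (hGcov hmem)
  have hg𝔪 : gOf p.1 ∉ 𝔪 := (PrimeSpectrum.mem_basicOpen _ _).1 hp𝔪
  exact ht p hpG 𝔪 hg𝔪 hst

end BertiniAffine

end Literature.AlgebraicGeometry.Resolution

end
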